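import Literature.NumberTheory.Rogawski1990.ArchSchwartzOrbitalIntegralConvergenceElliptic   -- ★ p848739 (LH3-p04): (CONV-ell-final) `integrable_orbitalIntegrand_of_archSchwartzGL_of_isQuotientOf`
import Literature.NumberTheory.Rogawski1990.ArchEllipticOrbitVolumeGrowth                     -- ★ p848765 (LH3-p03): `haar_setOf_archHSGL_conj_le_of_elliptic_linear` (the `hgrp` token, e = 1∕2)
import HarnessLib

/-!
# Schwartz orbital integrals on `H_∞` CONVERGE at every totally elliptic `G`-regular class — no volume hypothesis left
# (end-to-end junction of the (CONV)∕(VOL) chain of line LH3; Harish-Chandra 1966 §9, Beuzart-Plessis 2020 §1.5)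

Topic `NumberTheory/Rogawski1990`; namespace `Literature.NumberTheory.Rogawski1990`.  THEOREMS ONLY (no definition, no instance, no notation, no axiom, no named fact,
no `sorry`).  Cell `pub/hodgecm-mathlib`, F0∕P3c line LH3 (crux H413 = `stmt-HodgeConjecture-24833`), seat LH3-p03 (g0), capstone claimed 2026-09-02 on the LH3 bus.
Composition ONLY: ★ `integrable_orbitalIntegrand_of_archSchwartzGL_of_isQuotientOf` (LH3-p04 p848739: (CONV) at a compact-centraliser class modulo the group-side growth `hgrp`)
∘ ★ `haar_setOf_archHSGL_conj_le_of_elliptic_linear` (LH3-p03 p848765: the group-side growth `ν_H{y ∣ archHSGL(ι_∞(yγy⁻¹)) ≤ R} ≤ A R^{1∕2}(1 + log R)^m` for a `γ` regular elliptic at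
every complex place, itself over ★ «places multiply» p848675, ★ (T2-out) p848722 (LH3-p02), ★ (VOL-grp-SL2) p848555∕p848577 and ★ (VOL-ell-id) p848531 (LH3-p04)).

THE STATEMENT.  For every Haar, right-invariant `ν_H` on `H_∞ = U(Φ₂)(L⁺ ⊗ ℝ) × U(Φ₁)(L⁺ ⊗ ℝ)`, every family `mH` of orbital measures that is the Weil-form quotient `dν_H ∕ dt_H` at
the `G`-regular classes ((W_H) of ★ `ArchCompatibleFamiliesH`: ★ `IsQuotientOf (IsArchGRegular L) νH tH`), every `g ∈ 𝒞(H_∞)` (★ `ArchSchwartzEndo L g`, or any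
★ `ArchSchwartzGL L 3 𝔩 (1∕2) ι_∞ g`) and every `G`-regular class `c` with compact centraliser whose `U(Φ₂)`-component is, at EVERY complex place, a `U(Φ₂)_w`-conjugate of a
regular point `torusMatrix(λ₁, λ₂)` of the compact Cartan: the orbital integrand `y Z(c.out) ↦ g(y · c.out · y⁻¹)` is `mH c`-integrable — ★ `classOrbitalIntegral mH g c` and the
summands of ★ `stableOrbitalIntegralRel (IsArchStablyConjH L) mH g ·` at such classes are honest Bochner integrals, not junk zeros (the A3 hardening of the letters O1∕O3′
of the stub-N9 leaf at these classes).  NOT HERE: classes with a split (hyperbolic) place ((VOL-split), DEAL #11), and the compactness of the centraliser from ellipticity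
(kept as the instance hypothesis of ★ p848739; cf. ★ `compactSpace_centralizer_of_isArchStablyConjH_of_archCongr_eq_archDiagTorus`).
HONEST LABEL: HC_CM is proved only modulo the 7 printed citations (2 remaining: hLiu418 = `stmt-HodgeConjecture-24832`, h413 = `stmt-HodgeConjecture-24833`) until rung 0 closes;
this file closes no organ (O1, O3′ are letters) — it certifies that their Schwartz-class orbital integrals are meaningful at the totally elliptic regular classes.

## References
* [BeuzartPlessis2020Asterisque] R. Beuzart-Plessis, Astérisque 418 (2020), §1.8 p. 39; §1.2 (1.2.2), (1.2.4) p. 21 (convergence of Schwartz orbital integrals).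
* [HarishChandra1966] Harish-Chandra, *Discrete series for semisimple Lie groups II*, Acta Math. 116 (1966), §9.
* [Rogawski1990] J. D. Rogawski, Ann. of Math. Stud. 123 (1990), §4.3 (4.3.1) p. 43, §4.9 Prop. 4.9.1 (a) p. 55, §14.3 p. 234.
-/

set_option autoImplicit false

noncomputable section

open MeasureTheory Set NumberField NumberField.InfinitePlace NumberField.mixedEmbedding
open Literature.MeasureTheory.Group Literature.NumberTheory.Automorphic Literature.NumberTheory.Automorphic.UnitaryGroup
open scoped ENNReal MatrixGroups Matrix

namespace Literature.NumberTheory.Rogawski1990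

section Endo

variable {L : Type} [Field L] [NumberField L] [IsCMField L]
    [MeasurableSpace (↥(UnitaryGroup.arch (↥(maximalRealSubfield L)) L (IsCMField.complexConj L) 2
          (Matrix.of fun i j : Fin 2 => if i.val + j.val + 1 = 2 then (1 : L) else 0)) ×
        ↥(UnitaryGroup.arch (↥(maximalRealSubfield L)) L (IsCMField.complexConj L) 1
          (Matrix.of fun i j : Fin 1 => if i.val + j.val + 1 = 1 then (1 : L) else 0)))]
    [BorelSpace (↥(UnitaryGroup.arch (↥(maximalRealSubfield L)) L (IsCMField.complexConj L) 2
          (Matrix.of fun i j : Fin 2 => if i.val + j.val + 1 = 2 then (1 : L) else 0)) ×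
        ↥(UnitaryGroup.arch (↥(maximalRealSubfield L)) L (IsCMField.complexConj L) 1
          (Matrix.of fun i j : Fin 1 => if i.val + j.val + 1 = 1 then (1 : L) else 0)))]

/-- **SCHWARTZ ORBITAL INTEGRALS CONVERGE AT THE TOTALLY ELLIPTIC `G`-REGULAR CLASSES OF `H_∞` (generic Schwartz class, `e = 1∕2`).**  For `ν_H` Haar and right-invariant,
`mH` the Weil-form quotient family at the `G`-regular classes ((W_H)), `g` in ★ `ArchSchwartzGL L 3 𝔩 (1∕2) ι_∞`, and a `G`-regular class `c` with compact centraliser whose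
`U(Φ₂)`-component is regular elliptic at every complex place (`= g₀ · torusMatrix λ₁ λ₂ · g₀⁻¹`, `λ₁ ≠ λ₂`): the orbital integrand of `g` at `c` is `mH c`-integrable
(★ p848739 ∘ ★ p848765; NO volume hypothesis). [cite: BeuzartPlessis2020Asterisque, §1.8 p. 39; §1.2 (1.2.2), (1.2.4) p. 21] [cite: HarishChandra1966, §9] [cite: Rogawski1990, §4.3 (4.3.1) p. 43] -/
theorem integrable_orbitalIntegrand_of_archSchwartzGL_of_elliptic
    (νH : Measure (↥(UnitaryGroup.arch (↥(maximalRealSubfield L)) L (IsCMField.complexConj L) 2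
          (Matrix.of fun i j : Fin 2 => if i.val + j.val + 1 = 2 then (1 : L) else 0)) ×
        ↥(UnitaryGroup.arch (↥(maximalRealSubfield L)) L (IsCMField.complexConj L) 1
          (Matrix.of fun i j : Fin 1 => if i.val + j.val + 1 = 1 then (1 : L) else 0))))
    [νH.IsHaarMeasure] [νH.IsMulRightInvariant]
    [∀ a : (↥(UnitaryGroup.arch (↥(maximalRealSubfield L)) L (IsCMField.complexConj L) 2
          (Matrix.of fun i j : Fin 2 => if i.val + j.val + 1 = 2 then (1 : L) else 0)) ×
        ↥(UnitaryGroup.arch (↥(maximalRealSubfield L)) L (IsCMField.complexConj L) 1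
          (Matrix.of fun i j : Fin 1 => if i.val + j.val + 1 = 1 then (1 : L) else 0))),
      MeasurableSpace ((↥(UnitaryGroup.arch (↥(maximalRealSubfield L)) L (IsCMField.complexConj L) 2
          (Matrix.of fun i j : Fin 2 => if i.val + j.val + 1 = 2 then (1 : L) else 0)) ×
        ↥(UnitaryGroup.arch (↥(maximalRealSubfield L)) L (IsCMField.complexConj L) 1
          (Matrix.of fun i j : Fin 1 => if i.val + j.val + 1 = 1 then (1 : L) else 0))) ⧸ Subgroup.centralizer ({a} : Set _))]
    [∀ a : (↥(UnitaryGroup.arch (↥(maximalRealSubfield L)) L (IsCMField.complexConj L) 2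
          (Matrix.of fun i j : Fin 2 => if i.val + j.val + 1 = 2 then (1 : L) else 0)) ×
        ↥(UnitaryGroup.arch (↥(maximalRealSubfield L)) L (IsCMField.complexConj L) 1
          (Matrix.of fun i j : Fin 1 => if i.val + j.val + 1 = 1 then (1 : L) else 0))),
      BorelSpace ((↥(UnitaryGroup.arch (↥(maximalRealSubfield L)) L (IsCMField.complexConj L) 2
          (Matrix.of fun i j : Fin 2 => if i.val + j.val + 1 = 2 then (1 : L) else 0)) ×
        ↥(UnitaryGroup.arch (↥(maximalRealSubfield L)) L (IsCMField.complexConj L) 1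
          (Matrix.of fun i j : Fin 1 => if i.val + j.val + 1 = 1 then (1 : L) else 0))) ⧸ Subgroup.centralizer ({a} : Set _))]
    (tH : ∀ γH : (↥(UnitaryGroup.arch (↥(maximalRealSubfield L)) L (IsCMField.complexConj L) 2
          (Matrix.of fun i j : Fin 2 => if i.val + j.val + 1 = 2 then (1 : L) else 0)) ×
        ↥(UnitaryGroup.arch (↥(maximalRealSubfield L)) L (IsCMField.complexConj L) 1
          (Matrix.of fun i j : Fin 1 => if i.val + j.val + 1 = 1 then (1 : L) else 0))),
      Measure ↥(Subgroup.centralizer ({γH} : Set _)))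
    (mH : OrbitalMeasureFamily (↥(UnitaryGroup.arch (↥(maximalRealSubfield L)) L (IsCMField.complexConj L) 2
          (Matrix.of fun i j : Fin 2 => if i.val + j.val + 1 = 2 then (1 : L) else 0)) ×
        ↥(UnitaryGroup.arch (↥(maximalRealSubfield L)) L (IsCMField.complexConj L) 1
          (Matrix.of fun i j : Fin 1 => if i.val + j.val + 1 = 1 then (1 : L) else 0))))
    (hW : mH.IsQuotientOf (IsArchGRegular L) νH tH)
    (𝔩 : Set (Matrix (Fin 3) (Fin 3) (mixedSpace L)))
    {g : (↥(UnitaryGroup.arch (↥(maximalRealSubfield L)) L (IsCMField.complexConj L) 2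
          (Matrix.of fun i j : Fin 2 => if i.val + j.val + 1 = 2 then (1 : L) else 0)) ×
        ↥(UnitaryGroup.arch (↥(maximalRealSubfield L)) L (IsCMField.complexConj L) 1
          (Matrix.of fun i j : Fin 1 => if i.val + j.val + 1 = 1 then (1 : L) else 0))) → ℂ}
    (hg : ArchSchwartzGL L 3 𝔩 (1 / (2 : ℝ)) (fun k => ((endoEmbArch L k).val : GL (Fin 3) (mixedSpace L))) g)
    (c : ConjClasses (↥(UnitaryGroup.arch (↥(maximalRealSubfield L)) L (IsCMField.complexConj L) 2
          (Matrix.of fun i j : Fin 2 => if i.val + j.val + 1 = 2 then (1 : L) else 0)) ×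
        ↥(UnitaryGroup.arch (↥(maximalRealSubfield L)) L (IsCMField.complexConj L) 1
          (Matrix.of fun i j : Fin 1 => if i.val + j.val + 1 = 1 then (1 : L) else 0))))
    (hc : IsArchGRegular L (Quotient.out c))
    [CompactSpace ↥(Subgroup.centralizer ({Quotient.out c} : Set (↥(UnitaryGroup.arch (↥(maximalRealSubfield L)) L (IsCMField.complexConj L) 2
          (Matrix.of fun i j : Fin 2 => if i.val + j.val + 1 = 2 then (1 : L) else 0)) ×
        ↥(UnitaryGroup.arch (↥(maximalRealSubfield L)) L (IsCMField.complexConj L) 1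
          (Matrix.of fun i j : Fin 1 => if i.val + j.val + 1 = 1 then (1 : L) else 0)))))]
    (hell : ∀ w : {w : InfinitePlace L // w.IsComplex},
      ∃ (g₀ : ↥(archLocal L 2 (Matrix.of fun i j : Fin 2 => if i.val + j.val + 1 = 2 then (1 : L) else 0) w)) (l₁ l₂ : ℂ), l₁ ≠ l₂ ∧
        (((archPiEquivCM 2 L (Matrix.of fun i j : Fin 2 => if i.val + j.val + 1 = 2 then (1 : L) else 0) (Quotient.out c).1 w : ↥(archLocal L 2 (Matrix.of fun i j : Fin 2 => if i.val + j.val + 1 = 2 then (1 : L) else 0) w)) : GL (Fin 2) ℂ) : Matrix (Fin 2) (Fin 2) ℂ) =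
          ((g₀ : GL (Fin 2) ℂ) : Matrix (Fin 2) (Fin 2) ℂ) * torusMatrix l₁ l₂ * (((g₀ : GL (Fin 2) ℂ)) : Matrix (Fin 2) (Fin 2) ℂ)⁻¹) :
    Integrable (descConj (Quotient.out c) (Subgroup.centralizer ({Quotient.out c} : Set _))
      (fun _ h => Subgroup.mem_centralizer_singleton_iff.1 h) g) (mH c) :=
  integrable_orbitalIntegrand_of_archSchwartzGL_of_isQuotientOf νH tH mH hW 𝔩 (by norm_num) hg c hc
    (haar_setOf_archHSGL_conj_le_of_elliptic_linear L νH (Quotient.out c) hell)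

/-- **THE SAME FOR `𝒞(H_∞)` BY NAME** (★ `ArchSchwartzEndo L g` = the stub-N9 leaf's D1 through the ED. 2 bridge `archSchwartzH_iff_archSchwartzEndo`): at every totally elliptic
`G`-regular class with compact centraliser, the orbital integrand of a Harish-Chandra Schwartz function is integrable for the Weil-form family — the orbital integrals in the
letters O1 (Shelstad's Schwartz transfer) and O3′ (Bouaziz's replacement) are honest there. [cite: BeuzartPlessis2020Asterisque, §1.8 p. 39; §1.2 (1.2.2), (1.2.4) p. 21]
[cite: HarishChandra1966, §9] [cite: Rogawski1990, §4.9 Prop. 4.9.1 (a) p. 55; §14.3 p. 234] -/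
theorem integrable_orbitalIntegrand_of_archSchwartzEndo_of_elliptic
    (νH : Measure (↥(UnitaryGroup.arch (↥(maximalRealSubfield L)) L (IsCMField.complexConj L) 2
          (Matrix.of fun i j : Fin 2 => if i.val + j.val + 1 = 2 then (1 : L) else 0)) ×
        ↥(UnitaryGroup.arch (↥(maximalRealSubfield L)) L (IsCMField.complexConj L) 1
          (Matrix.of fun i j : Fin 1 => if i.val + j.val + 1 = 1 then (1 : L) else 0))))
    [νH.IsHaarMeasure] [νH.IsMulRightInvariant]
    [∀ a : (↥(UnitaryGroup.arch (↥(maximalRealSubfield L)) L (IsCMField.complexConj L) 2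
          (Matrix.of fun i j : Fin 2 => if i.val + j.val + 1 = 2 then (1 : L) else 0)) ×
        ↥(UnitaryGroup.arch (↥(maximalRealSubfield L)) L (IsCMField.complexConj L) 1
          (Matrix.of fun i j : Fin 1 => if i.val + j.val + 1 = 1 then (1 : L) else 0))),
      MeasurableSpace ((↥(UnitaryGroup.arch (↥(maximalRealSubfield L)) L (IsCMField.complexConj L) 2
          (Matrix.of fun i j : Fin 2 => if i.val + j.val + 1 = 2 then (1 : L) else 0)) ×
        ↥(UnitaryGroup.arch (↥(maximalRealSubfield L)) L (IsCMField.complexConj L) 1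
          (Matrix.of fun i j : Fin 1 => if i.val + j.val + 1 = 1 then (1 : L) else 0))) ⧸ Subgroup.centralizer ({a} : Set _))]
    [∀ a : (↥(UnitaryGroup.arch (↥(maximalRealSubfield L)) L (IsCMField.complexConj L) 2
          (Matrix.of fun i j : Fin 2 => if i.val + j.val + 1 = 2 then (1 : L) else 0)) ×
        ↥(UnitaryGroup.arch (↥(maximalRealSubfield L)) L (IsCMField.complexConj L) 1
          (Matrix.of fun i j : Fin 1 => if i.val + j.val + 1 = 1 then (1 : L) else 0))),
      BorelSpace ((↥(UnitaryGroup.arch (↥(maximalRealSubfield L)) L (IsCMField.complexConj L) 2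
          (Matrix.of fun i j : Fin 2 => if i.val + j.val + 1 = 2 then (1 : L) else 0)) ×
        ↥(UnitaryGroup.arch (↥(maximalRealSubfield L)) L (IsCMField.complexConj L) 1
          (Matrix.of fun i j : Fin 1 => if i.val + j.val + 1 = 1 then (1 : L) else 0))) ⧸ Subgroup.centralizer ({a} : Set _))]
    (tH : ∀ γH : (↥(UnitaryGroup.arch (↥(maximalRealSubfield L)) L (IsCMField.complexConj L) 2
          (Matrix.of fun i j : Fin 2 => if i.val + j.val + 1 = 2 then (1 : L) else 0)) ×
        ↥(UnitaryGroup.arch (↥(maximalRealSubfield L)) L (IsCMField.complexConj L) 1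
          (Matrix.of fun i j : Fin 1 => if i.val + j.val + 1 = 1 then (1 : L) else 0))),
      Measure ↥(Subgroup.centralizer ({γH} : Set _)))
    (mH : OrbitalMeasureFamily (↥(UnitaryGroup.arch (↥(maximalRealSubfield L)) L (IsCMField.complexConj L) 2
          (Matrix.of fun i j : Fin 2 => if i.val + j.val + 1 = 2 then (1 : L) else 0)) ×
        ↥(UnitaryGroup.arch (↥(maximalRealSubfield L)) L (IsCMField.complexConj L) 1
          (Matrix.of fun i j : Fin 1 => if i.val + j.val + 1 = 1 then (1 : L) else 0))))
    (hW : mH.IsQuotientOf (IsArchGRegular L) νH tH)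
    {g : (↥(UnitaryGroup.arch (↥(maximalRealSubfield L)) L (IsCMField.complexConj L) 2
          (Matrix.of fun i j : Fin 2 => if i.val + j.val + 1 = 2 then (1 : L) else 0)) ×
        ↥(UnitaryGroup.arch (↥(maximalRealSubfield L)) L (IsCMField.complexConj L) 1
          (Matrix.of fun i j : Fin 1 => if i.val + j.val + 1 = 1 then (1 : L) else 0))) → ℂ}
    (hg : ArchSchwartzEndo L g)
    (c : ConjClasses (↥(UnitaryGroup.arch (↥(maximalRealSubfield L)) L (IsCMField.complexConj L) 2
          (Matrix.of fun i j : Fin 2 => if i.val + j.val + 1 = 2 then (1 : L) else 0)) ×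
        ↥(UnitaryGroup.arch (↥(maximalRealSubfield L)) L (IsCMField.complexConj L) 1
          (Matrix.of fun i j : Fin 1 => if i.val + j.val + 1 = 1 then (1 : L) else 0))))
    (hc : IsArchGRegular L (Quotient.out c))
    [CompactSpace ↥(Subgroup.centralizer ({Quotient.out c} : Set (↥(UnitaryGroup.arch (↥(maximalRealSubfield L)) L (IsCMField.complexConj L) 2
          (Matrix.of fun i j : Fin 2 => if i.val + j.val + 1 = 2 then (1 : L) else 0)) ×
        ↥(UnitaryGroup.arch (↥(maximalRealSubfield L)) L (IsCMField.complexConj L) 1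
          (Matrix.of fun i j : Fin 1 => if i.val + j.val + 1 = 1 then (1 : L) else 0)))))]
    (hell : ∀ w : {w : InfinitePlace L // w.IsComplex},
      ∃ (g₀ : ↥(archLocal L 2 (Matrix.of fun i j : Fin 2 => if i.val + j.val + 1 = 2 then (1 : L) else 0) w)) (l₁ l₂ : ℂ), l₁ ≠ l₂ ∧
        (((archPiEquivCM 2 L (Matrix.of fun i j : Fin 2 => if i.val + j.val + 1 = 2 then (1 : L) else 0) (Quotient.out c).1 w : ↥(archLocal L 2 (Matrix.of fun i j : Fin 2 => if i.val + j.val + 1 = 2 then (1 : L) else 0) w)) : GL (Fin 2) ℂ) : Matrix (Fin 2) (Fin 2) ℂ) =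
          ((g₀ : GL (Fin 2) ℂ) : Matrix (Fin 2) (Fin 2) ℂ) * torusMatrix l₁ l₂ * (((g₀ : GL (Fin 2) ℂ)) : Matrix (Fin 2) (Fin 2) ℂ)⁻¹) :
    Integrable (descConj (Quotient.out c) (Subgroup.centralizer ({Quotient.out c} : Set _))
      (fun _ h => Subgroup.mem_centralizer_singleton_iff.1 h) g) (mH c) :=
  integrable_orbitalIntegrand_of_archSchwartzGL_of_elliptic νH tH mH hW (archEndoLie L) hg c hc hell

end Endo

end Literature.NumberTheory.Rogawski1990

end
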